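import Literature.Geometry.Kaehler.RiemannSurfaceUnramifiedCoveringClassification
import Literature.Geometry.Kaehler.RiemannSurfaceDeckTransformationsFunctionField
import HarnessLib

/-!
# Function fields of unramified holomorphic coverings: `[𝒦(Y) : q^*𝒦(N)] = [π₁(N) : q_*π₁(Y)]`, `Aut(𝒦(Y)/q^*𝒦(N)) ≅ N(H)/H`, and «Galois ⇔ normal» (Forster 8.3, 8.12 with Hatcher 1.39)

Topic `Literature/Geometry/Kaehler` — the bridge between the lane's two Galois theories of a compact Riemann
surface: the TOPOLOGICAL one (`Topology/CoveringSpaces/CoveringDeckTransformations`: Hatcher Prop. 1.39, the deck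
group `G(Y) ≅ N(H)/H` of a connected cover with `H = q_* π₁(Y, e₀)`, normal covers) and the FIELD-THEORETIC one
(`RiemannSurfaceDeckTransformationsFunctionField`: Forster 8.12, `Deck(Y/N) ≅ Aut(𝒦(Y)/q^*𝒦(N))`, `|Deck| ≤ deg q`,
Galois iff `|Deck| = deg q`; `RiemannSurfaceFunctionFieldExtensionDegree`: Forster 8.3, `[𝒦(Y) : q^*𝒦(N)] = deg q`),
joined through `RiemannSurfaceUnramifiedCoveringClassification` §5 (topological deck transformations of an unramified
holomorphic covering are conformal automorphisms).

Setting: `q : Y → N` an unramified holomorphic covering map of compact connected Riemann surfaces (`MDifferentiable`,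
`IsCoveringMap`, non-constant), `e₀ ∈ q⁻¹(x₀)`, `H = q_* π₁(Y, e₀) ≤ π₁(N, x₀)`, `K = q^*𝒦(N) ⊆ 𝒦(Y)` the pulled-back
function field (`FunctionField.comap`).

## What is proved (everything; no definitions, no instances, no named facts)

* §1 **`exists_mulEquiv_deckTransformations_deckGroup`** — `G(Y) = Deck(Y/N)`: the topological deck group
  (`ComplexTorus.deckTransformations q ≤ Homeo Y`) and Forster's `deckGroup q ≤ Aut Y` are isomorphic compatibly with
  their actions; `natCard_deckGroup_eq`;
* §2 **`finrank_fieldRange_comap_eq_index`** — `[𝒦(Y) : q^*𝒦(N)] = [π₁(N, x₀) : q_* π₁(Y, e₀)]` (= the number of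
  sheets; Forster 8.3 + Hatcher 1.32);
* §3 **`nonempty_algEquiv_mulEquiv_normalizer_quotient`** — `Aut(𝒦(Y)/q^*𝒦(N)) ≅ N(H)/H` (Forster 8.12 + Hatcher
  1.39 (b)); `natCard_algEquiv_le_index`;
* §4 **`normal_range_mapOfEq_iff_isGalois`** — `H ⊴ π₁(N, x₀)` (the covering is normal = regular) iff
  `𝒦(Y)/q^*𝒦(N)` is a Galois extension (Forster 8.12, last sentence, with Hatcher 1.39 (a)), through
  `normal_range_mapOfEq_iff_natCard_deckGroup_eq` (`⇔ |Deck| =` number of sheets);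
  **`nonempty_algEquiv_mulEquiv_quotient_of_normal`** — then `Gal(𝒦(Y)/q^*𝒦(N)) ≅ π₁(N, x₀) ⧸ H` and
  `|Gal| = [π₁ : H]`;
* §5 **`exists_isGalois_functionField_of_surjective`** — every finite quotient `G` of `π₁(N, x₀)` is the Galois
  group of an unramified Galois extension of `𝒦(N)`: the function field of the compact Riemann surface
  `Ñ ⧸ ker` (`RiemannSurface.exists_covering_of_normal_subgroup`) is Galois over `q^*𝒦(N)` with group `≅ G`.

## References
* O. Forster, *Lectures on Riemann Surfaces*, GTM 81, Springer 1981, §5.4–5.6 (Galois coverings), §8.3 Theorem,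
  §8.12 Theorem. [Forster1981]
* A. Hatcher, *Algebraic Topology*, CUP 2002, §1.3 Prop. 1.32 (p. 61), Prop. 1.36 (p. 68), Prop. 1.39 (p. 71). [HatcherAT2002]
* R. Miranda, *Algebraic Curves and Riemann Surfaces*, AMS 1995, Chapter VI Proposition 1.21. [Miranda1995]
-/

noncomputable section

open scoped Manifold ContDiff Topology IntermediateField
open Set Function MulAction Module

namespace Literature.Geometry.Kaehler

open Literature.Topology.CoveringSpaces Literature.Topology.CoveringSpaces.CoverDeck
open Literature.Geometry.Kaehler.ComplexTorus (deckTransformations mem_deckTransformations_iff deck_eq_of_apply_eq)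

namespace RiemannSurface

open FunctionField

universe u v

variable {N : Type u} [TopologicalSpace N] [ChartedSpace ℂ N] [ConnectedSpace N] [IsManifold 𝓘(ℂ, ℂ) ω N]
  [CompactSpace N] [T2Space N]
  {Y : Type v} [TopologicalSpace Y] [ChartedSpace ℂ Y] [ConnectedSpace Y] [IsManifold 𝓘(ℂ, ℂ) ω Y]
  [CompactSpace Y] [T2Space Y]
  {q : Y → N} (hq : MDifferentiable 𝓘(ℂ, ℂ) 𝓘(ℂ, ℂ) q) (hne : ∃ a b, q a ≠ q b) (hc : IsCoveringMap q)

/-! ### §1 Topological and conformal deck transformations agree -/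

include hq hc in
omit [CompactSpace N] [T2Space Y] in
/-- **`G(Y) ≅ Deck(Y/N)`**: for an unramified holomorphic covering `q : Y → N` of compact connected Riemann surfaces
the group of fibre-preserving self-HOMEOMORPHISMS of `Y` (`deckTransformations q`) and Forster's group of
fibre-preserving CONFORMAL automorphisms (`deckGroup q ≤ Aut Y`) are isomorphic, compatibly with their actions on
`Y` (every topological deck transformation is biholomorphic, Forster 4.6; every conformal one is a homeomorphism).
[cite: Forster1981, §4 Thm. 4.6, §5.4 Definition] [cite: HatcherAT2002, §1.3 Prop. 1.39 (p. 71)] -/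
theorem exists_mulEquiv_deckTransformations_deckGroup :
    ∃ Φ : deckTransformations q ≃* deckGroup q,
      ∀ (f : deckTransformations q) (y : Y), ((Φ f : deckGroup q) : autGroup Y) • y = (f : Y ≃ₜ Y) y := by
  obtain ⟨ι, hι, hιapp⟩ := exists_monoidHom_deckTransformations_autGroup hc hq
  have hrange : ι.range = deckGroup q := by
    ext σ
    constructor
    · rintro ⟨f, rfl⟩
      rw [mem_deckGroup_iff]
      intro x
      rw [Subgroup.smul_def, Equiv.Perm.smul_def, hιapp]
      exact (mem_deckTransformations_iff q _).1 f.2 x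
    · intro hσ
      -- `σ` and `σ⁻¹` are holomorphic, hence continuous: `σ` is a homeomorphism over `N`
      let f : Y ≃ₜ Y :=
        { toEquiv := ((σ : autGroup Y) : Equiv.Perm Y)
          continuous_toFun := σ.2.1.continuous
          continuous_invFun := σ.2.2.continuous }
      have hf : f ∈ deckTransformations q := fun y ↦ mem_deckGroup_iff.1 hσ y
      refine ⟨⟨f, hf⟩, Subtype.ext (Equiv.ext fun y ↦ ?_)⟩
      rw [hιapp]
      rfl
  refine ⟨(MonoidHom.ofInjective hι).trans (MulEquiv.subgroupCongr hrange), fun f y ↦ ?_⟩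
  rw [Subgroup.smul_def, Equiv.Perm.smul_def]
  exact hιapp f y

include hq hc in
omit [CompactSpace N] [T2Space Y] in
/-- `|Deck(Y/N)| = |G(Y)|`. [cite: Forster1981, §5.4 Definition] [cite: HatcherAT2002, §1.3 Prop. 1.39] -/
theorem natCard_deckGroup_eq : Nat.card (deckGroup q) = Nat.card (deckTransformations q) := by
  obtain ⟨Φ, -⟩ := exists_mulEquiv_deckTransformations_deckGroup hq hc
  exact (Nat.card_congr Φ.toEquiv).symm

/-! ### §2 `[𝒦(Y) : q^*𝒦(N)] = [π₁(N, x₀) : q_* π₁(Y, e₀)]` -/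

include hq hne hc in
omit [CompactSpace N] [T2Space Y] in
/-- All fibres of the unramified `q` have total multiplicity the number `#q⁻¹(x₀)` of sheets.
[cite: FarkasKra1992, I.2.7] [cite: HatcherAT2002, §1.3 Prop. 1.32] -/
theorem finsum_ramificationNumber_eq_ncard (x₀ Q : N) :
    ∑ᶠ P ∈ q ⁻¹' {Q}, ramificationNumber q P = (q ⁻¹' {x₀}).ncard := by
  haveI := pathConnectedSpace_of_connectedSpace N
  rw [← ncard_preimage_singleton_eq_finsum hq hne (fun P _ ↦ hc.ramificationNumber_eq_one hq hne P),
    hc.ncard_preimage_singleton_eq Q x₀]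

/-- **`[𝒦(Y) : q^*𝒦(N)] = [π₁(N, x₀) : q_* π₁(Y, e₀)]`** for an unramified holomorphic covering of compact connected
Riemann surfaces: both are the number of sheets (Forster 8.3: the degree of the function field extension is
`deg q`; Hatcher 1.32: the number of sheets is the index). [cite: Forster1981, §8.3 Theorem]
[cite: HatcherAT2002, §1.3 Prop. 1.32 (p. 61)] -/
theorem finrank_fieldRange_comap_eq_index {x₀ : N} (e₀ : q ⁻¹' {x₀}) :
    finrank ↥(comap q hq hne).fieldRange (FunctionField Y) =
      (FundamentalGroup.mapOfEq ⟨q, hc.continuous⟩ e₀.2).range.index := by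
  rw [FunctionField.finrank_fieldRange_comap hq hne (finsum_ramificationNumber_eq_ncard hq hne hc x₀),
    ncard_preimage_eq_index_range_mapOfEq hc e₀ x₀]

/-! ### §3 `Aut(𝒦(Y)/q^*𝒦(N)) ≅ N(H)/H` -/

/-- **`Aut(𝒦(Y)/q^*𝒦(N)) ≅ N(H)/H`**, `H = q_* π₁(Y, e₀)`, `N(H)` its normaliser in `π₁(N, x₀)`: Forster 8.12
(`Aut ≅ Deck(Y/N)`) composed with Hatcher 1.39 (b) (`G(Y) ≅ N(H)/H`).
[cite: Forster1981, §8.12 Theorem] [cite: HatcherAT2002, §1.3 Prop. 1.39 (p. 71)] -/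
theorem nonempty_algEquiv_mulEquiv_normalizer_quotient {x₀ : N} (e₀ : q ⁻¹' {x₀}) :
    Nonempty ((FunctionField Y ≃ₐ[↥(comap q hq hne).fieldRange] FunctionField Y) ≃*
      (Subgroup.normalizer ((FundamentalGroup.mapOfEq ⟨q, hc.continuous⟩ e₀.2).range :
          Set (FundamentalGroup N x₀)) ⧸
        ((FundamentalGroup.mapOfEq ⟨q, hc.continuous⟩ e₀.2).range).subgroupOf
          (Subgroup.normalizer ((FundamentalGroup.mapOfEq ⟨q, hc.continuous⟩ e₀.2).range :
            Set (FundamentalGroup N x₀))))) := by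
  haveI := pathConnectedSpace_of_connectedSpace Y
  haveI := ChartedSpace.locallyPathConnectedSpace ℂ Y
  obtain ⟨e⟩ := nonempty_mulEquiv_normalizer_quotient hc e₀
  obtain ⟨Φ, -⟩ := exists_mulEquiv_deckTransformations_deckGroup hq hc
  exact ⟨(deckGroupMulEquiv hq hne).symm.trans (Φ.symm.trans e.symm)⟩

/-- `|Aut(𝒦(Y)/q^*𝒦(N))| = |G(Y)| ≤ [π₁(N, x₀) : H]`, the number of sheets. [cite: Forster1981, §8.12 Theorem]
[cite: HatcherAT2002, §1.3 Prop. 1.39 (p. 71)] -/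
theorem natCard_algEquiv_le_index {x₀ : N} (e₀ : q ⁻¹' {x₀}) :
    Nat.card (FunctionField Y ≃ₐ[↥(comap q hq hne).fieldRange] FunctionField Y) ≤
      (FundamentalGroup.mapOfEq ⟨q, hc.continuous⟩ e₀.2).range.index := by
  rw [← card_deckGroup_eq_card_algEquiv hq hne, ← ncard_preimage_eq_index_range_mapOfEq hc e₀ x₀]
  exact card_deckGroup_le hq hne (finsum_ramificationNumber_eq_ncard hq hne hc x₀)

/-! ### §4 Normal coverings ⇔ Galois extensions; `Gal ≅ π₁ ⧸ H` -/

include hq hc in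
omit [CompactSpace N] [T2Space Y] in
/-- **A connected unramified holomorphic covering is normal iff it has as many deck transformations as sheets**:
`q_* π₁(Y, e₀) ⊴ π₁(N, x₀)` iff `|Deck(Y/N)| = #q⁻¹(x₀)` (Hatcher 1.39: normal iff `G(Y)` is transitive on a fibre;
`G(Y)` acts freely on the fibre, so transitive iff `|G(Y)| = #` fibre).
[cite: HatcherAT2002, §1.3 Prop. 1.39 (p. 71)] [cite: Forster1981, §5.6] -/
theorem normal_range_mapOfEq_iff_natCard_deckGroup_eq {x₀ : N} (e₀ : q ⁻¹' {x₀}) :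
    (FundamentalGroup.mapOfEq ⟨q, hc.continuous⟩ e₀.2).range.Normal ↔
      Nat.card (deckGroup q) = (q ⁻¹' {x₀}).ncard := by
  haveI := pathConnectedSpace_of_connectedSpace Y
  haveI := ChartedSpace.locallyPathConnectedSpace ℂ Y
  rw [natCard_deckGroup_eq hq hc]
  constructor
  · intro hN
    exact (natCard_deckTransformations_of_normal hc e₀ hN).2
  · intro hcard
    -- evaluation at `e₀` is injective `G(Y) → q⁻¹(x₀)` between finite sets of the same size, hence onto
    haveI : Finite (q ⁻¹' {x₀}) := (hc.finite_preimage_singleton_of_compactSpace x₀).to_subtype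
    let ev : deckTransformations q → q ⁻¹' {x₀} := fun f ↦
      ⟨(f : Y ≃ₜ Y) e₀, by rw [mem_preimage, (mem_deckTransformations_iff q _).1 f.2]; exact e₀.2⟩
    have hinj : Injective ev := fun f g hfg ↦
      Subtype.ext (deck_eq_of_apply_eq hc f.2 g.2 (congrArg Subtype.val hfg))
    have hbij : Bijective ev := hinj.bijective_of_nat_card_le (by rw [hcard]; rfl)
    refine (forall_exists_deck_apply_eq_fibre_iff_normal hc e₀).1 fun e e' ↦ ?_
    obtain ⟨f₁, hf₁⟩ := hbij.2 e
    obtain ⟨f₂, hf₂⟩ := hbij.2 e'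
    refine ⟨(f₂ : Y ≃ₜ Y) * (f₁ : Y ≃ₜ Y)⁻¹, mul_mem f₂.2 (inv_mem f₁.2), ?_⟩
    have h1 : (f₁ : Y ≃ₜ Y) e₀ = e := congrArg Subtype.val hf₁
    have h2 : (f₂ : Y ≃ₜ Y) e₀ = e' := congrArg Subtype.val hf₂
    rw [Homeomorph.mul_apply, Homeomorph.inv_apply, ← h1, Homeomorph.symm_apply_apply, h2]

/-- **«The covering `Y → X` is Galois precisely if the field extension `L : K` is Galois»**, unramified case, joined
to Hatcher 1.39: `q_* π₁(Y, e₀)` is a NORMAL subgroup of `π₁(N, x₀)` iff `𝒦(Y)/q^*𝒦(N)` is a Galois extension.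
[cite: Forster1981, §8.12 Theorem (last statement)] [cite: HatcherAT2002, §1.3 Prop. 1.39 (p. 71)] -/
theorem normal_range_mapOfEq_iff_isGalois {x₀ : N} (e₀ : q ⁻¹' {x₀}) :
    (FundamentalGroup.mapOfEq ⟨q, hc.continuous⟩ e₀.2).range.Normal ↔
      IsGalois ↥(comap q hq hne).fieldRange (FunctionField Y) := by
  rw [isGalois_fieldRange_comap_iff_card_deckGroup_eq hq hne (finsum_ramificationNumber_eq_ncard hq hne hc x₀),
    normal_range_mapOfEq_iff_natCard_deckGroup_eq hq hc e₀]

/-- **`Gal(𝒦(Y)/q^*𝒦(N)) ≅ π₁(N, x₀) ⧸ q_* π₁(Y, e₀)` for a normal unramified holomorphic covering** of compact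
connected Riemann surfaces (Forster 8.12 with Hatcher 1.39 (b), normal case).
[cite: Forster1981, §8.12 Theorem] [cite: HatcherAT2002, §1.3 Prop. 1.39 (p. 71)] -/
theorem nonempty_algEquiv_mulEquiv_quotient_of_normal {x₀ : N} (e₀ : q ⁻¹' {x₀})
    (hN : (FundamentalGroup.mapOfEq ⟨q, hc.continuous⟩ e₀.2).range.Normal) :
    Nonempty ((FunctionField Y ≃ₐ[↥(comap q hq hne).fieldRange] FunctionField Y) ≃*
      (FundamentalGroup N x₀ ⧸ (FundamentalGroup.mapOfEq ⟨q, hc.continuous⟩ e₀.2).range)) := by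
  haveI := pathConnectedSpace_of_connectedSpace Y
  haveI := ChartedSpace.locallyPathConnectedSpace ℂ Y
  obtain ⟨e⟩ := nonempty_mulEquiv_quotient_of_normal hc e₀ hN
  obtain ⟨Φ, -⟩ := exists_mulEquiv_deckTransformations_deckGroup hq hc
  exact ⟨(deckGroupMulEquiv hq hne).symm.trans (Φ.symm.trans e.symm)⟩

/-- For a normal unramified holomorphic covering, `𝒦(Y)/q^*𝒦(N)` is Galois with `|Gal| = [π₁(N, x₀) : H] =` the
number of sheets `= [𝒦(Y) : q^*𝒦(N)]`. [cite: Forster1981, §8.12 Theorem, §8.3] [cite: HatcherAT2002, §1.3 Prop. 1.39] -/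
theorem isGalois_and_natCard_algEquiv_eq_index_of_normal {x₀ : N} (e₀ : q ⁻¹' {x₀})
    (hN : (FundamentalGroup.mapOfEq ⟨q, hc.continuous⟩ e₀.2).range.Normal) :
    IsGalois ↥(comap q hq hne).fieldRange (FunctionField Y) ∧
      Nat.card (FunctionField Y ≃ₐ[↥(comap q hq hne).fieldRange] FunctionField Y) =
        (FundamentalGroup.mapOfEq ⟨q, hc.continuous⟩ e₀.2).range.index := by
  obtain ⟨e⟩ := nonempty_algEquiv_mulEquiv_quotient_of_normal hq hne hc e₀ hN
  exact ⟨(normal_range_mapOfEq_iff_isGalois hq hne hc e₀).1 hN,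
    by rw [Nat.card_congr e.toEquiv, Subgroup.index_eq_card]⟩

/-! ### §5 Every finite quotient of `π₁(N, x₀)` is an unramified Galois group over `𝒦(N)` -/

/-- **Every finite quotient of the fundamental group of a compact Riemann surface is the Galois group of an
unramified Galois extension of its function field.**  For a compact connected Riemann surface `N`, `x₀ : N` and a
surjection `φ : π₁(N, x₀) ↠ G` onto a finite group there are a compact connected Riemann surface `T` (the cover
`Ñ ⧸ ker φ`, in the universe of `N`) and an unramified holomorphic covering map `p : T → N` (non-constant) such that
`𝒦(T)` is a Galois extension of `p^*𝒦(N)` of degree `|G|` with Galois group isomorphic to `G`.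
[cite: Forster1981, §8.12 Theorem, §8.3] [cite: HatcherAT2002, §1.3 Prop. 1.36 (p. 68), Prop. 1.39 (p. 71)] -/
theorem exists_isGalois_functionField_of_surjective (x₀ : N) {G : Type*} [Group G] [Finite G]
    (φ : FundamentalGroup N x₀ →* G) (hφ : Surjective φ) :
    ∃ (T : Type u) (_ : TopologicalSpace T) (_ : ChartedSpace ℂ T) (_ : IsManifold 𝓘(ℂ, ℂ) ω T)
      (_ : CompactSpace T) (_ : T2Space T) (_ : ConnectedSpace T) (p : T → N)
      (hp : MDifferentiable 𝓘(ℂ, ℂ) 𝓘(ℂ, ℂ) p) (hpne : ∃ a b, p a ≠ p b),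
      IsCoveringMap p ∧ IsGalois ↥(comap p hp hpne).fieldRange (FunctionField T) ∧
        finrank ↥(comap p hp hpne).fieldRange (FunctionField T) = Nat.card G ∧
        Nonempty ((FunctionField T ≃ₐ[↥(comap p hp hpne).fieldRange] FunctionField T) ≃* G) := by
  -- `K = ker φ`, normal of index `|G|`
  let K := φ.ker
  have hKi : K.index = Nat.card G := by
    rw [Subgroup.index_ker, MonoidHom.range_eq_top.2 hφ, Subgroup.card_top]
  haveI : K.FiniteIndex := ⟨by rw [hKi]; exact Nat.card_pos.ne'⟩
  obtain ⟨T, i1, i2, i3, i4, i5, i6, p, hpc, y, hy, hpd, -, -, -, hrange, -⟩ :=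
    exists_covering_of_normal_subgroup x₀ K
  have hpne : ∃ a b, p a ≠ p b := hpc.exists_apply_ne_of_compactSpace
  have hK : (FundamentalGroup.mapOfEq ⟨p, hpc.continuous⟩ (⟨y, hy⟩ : p ⁻¹' {x₀}).2).range = K := hrange
  have hN : (FundamentalGroup.mapOfEq ⟨p, hpc.continuous⟩ (⟨y, hy⟩ : p ⁻¹' {x₀}).2).range.Normal := by
    rw [hK]
    infer_instance
  have hG := (isGalois_and_natCard_algEquiv_eq_index_of_normal hpd hpne hpc ⟨y, hy⟩ hN).1
  obtain ⟨e⟩ := nonempty_algEquiv_mulEquiv_quotient_of_normal hpd hpne hpc ⟨y, hy⟩ hN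
  refine ⟨T, i1, i2, i3, i4, i5, i6, p, hpd, hpne, hpc, hG, ?_, ?_⟩
  · rw [finrank_fieldRange_comap_eq_index hpd hpne hpc ⟨y, hy⟩, hK, hKi]
  · -- `Gal ≅ π₁ ⧸ p_*π₁(T) = π₁ ⧸ ker φ ≅ G`
    exact ⟨e.trans ((QuotientGroup.quotientMulEquivOfEq hK).trans
      (QuotientGroup.quotientKerEquivOfSurjective φ hφ))⟩

end RiemannSurface

end Literature.Geometry.Kaehler

end
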